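import Summits.KontsevichZagierPeriods.KontsevichZagierPeriods.Theorems.MzvKernelInKZ.Negative.CalabiFourMap

/-!
# `MzvKernelInKZ` (stmt-KontsevichZagierPeriods-3914): negative side — the Calabi map in dimension 4 is onto the cube; `Q⁴ ≡ 6·[□⁴, 1/(1−∏xᵢ²)]`

Companion of `Negative/CalabiFourMap.lean`.  SURJECTIVITY of the Calabi map `P₄ → (0,1)⁴`: for
`x ∈ (0,1)⁴` put `sᵢ = (a − ab + abc − abcd)/(1 − abcd)` on the cyclic shifts of the squares
`a = xᵢ², …` (`sfun`); then `sᵢ ∈ (0,1)`, `sᵢ/(1 − sᵢ₊₁) = xᵢ²` (`sfun_div`), `sᵢ < 1 − sᵢ₊₁`, and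
the half-angles `tᵢ = T(sᵢ)` (`Tg`) lie in `P₄` and map to `x` (`image_cal4`).  With
`ℚ`-semialgebraicity (`isSemialgebraicMapOn_cal4`) and the transported integrability this makes
`[P₄, g⊗4] − [□⁴, 1/(1 − x₀²x₁²x₂²x₃²)]` ONE change-of-variables move (`P4rep_sub_L4rep_mem_cov`)
and **`[Q⁴] − 6 • [□⁴, 1/(1−∏xᵢ²)] ∈ KZ.relations`** (`of_G4_sub_six_L4rep_mem`;
`(π/2)⁴ = 6 · Σ_odd n⁻⁴`).

Sources: F. Beukers, J. A. C. Kolk, E. Calabi, *Sums of generalized harmonic series and volumes*, Nieuw Arch. Wisk. (4) 11 (1993), 217–224; M. Kontsevich, D. Zagier, *Periods* (2001), §1.2 (rule (2)).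
-/

noncomputable section

namespace Summit.KontsevichZagierPeriods.MzvKernelInKZ.Negative

open Set MeasureTheory MvPolynomial
open Literature.NumberTheory.Transcendental
open Literature.ModelTheory.ExponentialFields (IsSemialgebraic)

/-- BKC's inversion function: `s(a,b,c,d) = (a − ab + abc − abcd)/(1 − abcd)` (`= sin²u₀` in terms of
the squares `a = x₀², …, d = x₃²`). [folklore] -/
def sfun (a b c d : ℝ) : ℝ := (a - a * b + a * b * c - a * b * c * d) / (1 - a * b * c * d)

/-- A product of four numbers in `(0,1)` is `< 1`. [folklore] -/
theorem prod_lt_one4 {a b c d : ℝ} (ha : a ∈ Ioo (0 : ℝ) 1) (hb : b ∈ Ioo (0 : ℝ) 1) (hc : c ∈ Ioo (0 : ℝ) 1)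
    (hd : d ∈ Ioo (0 : ℝ) 1) : a * b * c * d < 1 := by
  have h1 := mul_lt_one_of_nonneg_of_lt_one_left ha.1.le ha.2 hb.2.le
  have h2 := mul_lt_one_of_nonneg_of_lt_one_left (mul_pos ha.1 hb.1).le h1 hc.2.le
  exact mul_lt_one_of_nonneg_of_lt_one_left (mul_pos (mul_pos ha.1 hb.1) hc.1).le h2 hd.2.le

/-- The cyclic key identity `s(a,b,c,d) = a · (1 − s(b,c,d,a))`. [folklore] -/
theorem sfun_key {a b c d : ℝ} (h : a * b * c * d < 1) : sfun a b c d = a * (1 - sfun b c d a) := by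
  have : 1 - a * b * c * d ≠ 0 := by linarith
  have : 1 - b * c * d * a ≠ 0 := by nlinarith
  simp only [sfun]
  field_simp
  ring

/-- BKC's `sin²` lies in `(0,1)`. [folklore] -/
theorem sfun_mem {a b c d : ℝ} (ha : a ∈ Ioo (0 : ℝ) 1) (hb : b ∈ Ioo (0 : ℝ) 1) (hc : c ∈ Ioo (0 : ℝ) 1)
    (hd : d ∈ Ioo (0 : ℝ) 1) : sfun a b c d ∈ Ioo (0 : ℝ) 1 := by
  have hX := prod_lt_one4 ha hb hc hd
  have hD : 0 < 1 - a * b * c * d := by linarith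
  -- `1 − b(1 − c(1 − d)) ∈ (0, 1]` and `1 − b(1 − c) ∈ (0,1]`
  have i1 : 0 ≤ c * (1 - d) ∧ c * (1 - d) < 1 :=
    ⟨mul_nonneg hc.1.le (by linarith [hd.2]), by nlinarith [hc.2, hd.1, hc.1]⟩
  have i2 : 0 ≤ b * (1 - c * (1 - d)) ∧ b * (1 - c * (1 - d)) < 1 :=
    ⟨mul_nonneg hb.1.le (by linarith [i1.2]), by nlinarith [hb.2, hb.1, i1.1]⟩
  have i3 : 0 ≤ b * (1 - c) ∧ b * (1 - c) < 1 :=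
    ⟨mul_nonneg hb.1.le (by linarith [hc.2]), by nlinarith [hb.2, hc.1, hb.1]⟩
  unfold sfun
  refine ⟨div_pos ?_ hD, (div_lt_one hD).mpr ?_⟩
  · have : a - a * b + a * b * c - a * b * c * d = a * (1 - b * (1 - c * (1 - d))) := by ring
    rw [this]; exact mul_pos ha.1 (by linarith [i2.2])
  · have : a - a * b + a * b * c = a * (1 - b * (1 - c)) := by ring
    have h4 : a * (1 - b * (1 - c)) < 1 := by nlinarith [ha.2, ha.1, i3.1, i3.2]
    linarith

/-- `sᵢ < 1 − sᵢ₊₁` (the polytope condition on the preimage). [folklore] -/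
theorem sfun_lt {a b c d : ℝ} (ha : a ∈ Ioo (0 : ℝ) 1) (hb : b ∈ Ioo (0 : ℝ) 1) (hc : c ∈ Ioo (0 : ℝ) 1)
    (hd : d ∈ Ioo (0 : ℝ) 1) : sfun a b c d < 1 - sfun b c d a := by
  have hs' := sfun_mem hb hc hd ha
  rw [sfun_key (prod_lt_one4 ha hb hc hd)]
  nlinarith [ha.2, hs'.2]

/-- `sᵢ/(1 − sᵢ₊₁) = xᵢ²`. [folklore] -/
theorem sfun_div {a b c d : ℝ} (ha : a ∈ Ioo (0 : ℝ) 1) (hb : b ∈ Ioo (0 : ℝ) 1) (hc : c ∈ Ioo (0 : ℝ) 1)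
    (hd : d ∈ Ioo (0 : ℝ) 1) : sfun a b c d / (1 - sfun b c d a) = a := by
  have hs' := sfun_mem hb hc hd ha
  rw [sfun_key (prod_lt_one4 ha hb hc hd), mul_div_assoc, div_self (by linarith [hs'.2]), mul_one]

/-- One coordinate of the preimage computation: `√s / √(1 − s') = x`. [folklore] -/
theorem sqrt_sfun_div {x a b c d : ℝ} (hx : 0 < x) (hxa : x ^ 2 = a) (ha : a ∈ Ioo (0 : ℝ) 1) (hb : b ∈ Ioo (0 : ℝ) 1)
    (hc : c ∈ Ioo (0 : ℝ) 1) (hd : d ∈ Ioo (0 : ℝ) 1) :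
    Real.sqrt (sfun a b c d) * (Real.sqrt (1 - sfun b c d a))⁻¹ = x := by
  rw [← div_eq_mul_inv, ← Real.sqrt_div (sfun_mem ha hb hc hd).1.le, sfun_div ha hb hc hd, ← hxa,
    Real.sqrt_sq hx.le]

/-- The image of the domain under `cal4`. [folklore] -/
theorem image_cal4 : cal4 '' P4set = openUnitCube 4 := by
  apply Subset.antisymm
  · rintro _ ⟨z, hz, rfl⟩; exact cal4_mem_cube hz
  · intro w hw
    have hw' := mem_cube4'.mp hw
    have sq : ∀ i, w i ^ 2 ∈ Ioo (0 : ℝ) 1 := fun i => ⟨pow_pos (hw' i).1 2, by nlinarith [(hw' i).1, (hw' i).2]⟩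
    set a := w 0 ^ 2; set b := w 1 ^ 2; set c := w 2 ^ 2; set d := w 3 ^ 2
    have ha : a ∈ Ioo (0:ℝ) 1 := sq 0
    have hb : b ∈ Ioo (0:ℝ) 1 := sq 1
    have hc : c ∈ Ioo (0:ℝ) 1 := sq 2
    have hd : d ∈ Ioo (0:ℝ) 1 := sq 3
    -- the four `sin²`
    set s0 := sfun a b c d; set s1 := sfun b c d a; set s2 := sfun c d a b; set s3 := sfun d a b c
    have m0 : s0 ∈ Ioo (0:ℝ) 1 := sfun_mem ha hb hc hd
    have m1 : s1 ∈ Ioo (0:ℝ) 1 := sfun_mem hb hc hd ha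
    have m2 : s2 ∈ Ioo (0:ℝ) 1 := sfun_mem hc hd ha hb
    have m3 : s3 ∈ Ioo (0:ℝ) 1 := sfun_mem hd ha hb hc
    obtain ⟨t0, S0, C0⟩ := Tg_facts m0
    obtain ⟨t1, S1, C1⟩ := Tg_facts m1
    obtain ⟨t2, S2, C2⟩ := Tg_facts m2
    obtain ⟨t3, S3, C3⟩ := Tg_facts m3
    have l01 : s0 < 1 - s1 := sfun_lt ha hb hc hd
    have l12 : s1 < 1 - s2 := sfun_lt hb hc hd ha
    have l23 : s2 < 1 - s3 := sfun_lt hc hd ha hb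
    have l30 : s3 < 1 - s0 := sfun_lt hd ha hb hc
    -- the polytope condition from `sᵢ < 1 − sᵢ₊₁`
    have czof : ∀ {p q : ℝ} (hp : p ∈ Ioo (0:ℝ) 1) (hq : q ∈ Ioo (0:ℝ) 1),
        Sn (Tg p) = Real.sqrt p → Cs (Tg q) = Real.sqrt (1 - q) → Tg p ∈ Ioo (0:ℝ) 1 → Tg q ∈ Ioo (0:ℝ) 1 →
        p < 1 - q → cz ![Tg p, Tg q, Tg p, Tg q] 0 1 := by
      intro p q hp hq Sp Cq tp tq hpq
      have hρ : Tg p < rho (Tg q) := by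
        rw [← Sn_lt_Sn_iff tp (rho_mem_Ioo tq), Sn_rho (show Tg q ≠ -1 by linarith [tq.1]), Sp, Cq]
        exact (Real.sqrt_lt_sqrt_iff hp.1.le).mpr hpq
      simpa [cz] using (cz_iff_lt_rho (show -1 < Tg q by linarith [tq.1])).mpr hρ
    refine ⟨![Tg s0, Tg s1, Tg s2, Tg s3], ?_, ?_⟩
    · rw [mem_P4set]
      refine ⟨fun i => ?_, ?_, ?_, ?_, ?_⟩
      · fin_cases i
        · simpa using t0
        · simpa using t1
        · simpa using t2
        · simpa using t3
      · simpa [cz] using czof m0 m1 S0 C1 t0 t1 l01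
      · simpa [cz] using czof m1 m2 S1 C2 t1 t2 l12
      · simpa [cz] using czof m2 m3 S2 C3 t2 t3 l23
      · simpa [cz] using czof m3 m0 S3 C0 t3 t0 l30
    · funext i; fin_cases i
      · simpa [cal4, S0, C1] using sqrt_sfun_div (hw' 0).1 rfl ha hb hc hd
      · simpa [cal4, S1, C2] using sqrt_sfun_div (hw' 1).1 rfl hb hc hd ha
      · simpa [cal4, S2, C3] using sqrt_sfun_div (hw' 2).1 rfl hc hd ha hb
      · simpa [cal4, S3, C0] using sqrt_sfun_div (hw' 3).1 rfl hd ha hb hc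

/-- `cal4` is a `ℚ`-semialgebraic map on its domain (rational or polynomial components). [folklore] -/
theorem isSemialgebraicMapOn_cal4 : IsSemialgebraicMapOn ℚ P4set cal4 := by
  refine IsSemialgebraicMapOn.of_forall sa_P4set fun j => ?_
  have comp : ∀ i k : Fin 4, IsSemialgebraicFunOn ℚ P4set fun z => Sn (z i) * (Cs (z k))⁻¹ := by
    intro i k
    refine (isSemialgebraicFunOn_aeval_div_aeval sa_P4set (2 * X i * (1 + X k ^ 2) : MvPolynomial (Fin 4) ℚ)
      ((1 + X i ^ 2) * (1 - X k ^ 2)) fun z hz => ?_).congr fun z hz => ?_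
    · obtain ⟨hb, -⟩ := mem_P4set.mp hz
      simp only [map_mul, map_add, map_one, map_pow, map_sub, aeval_X]
      exact mul_ne_zero (one_add_sq_ne _) (by nlinarith [(hb k).1, (hb k).2])
    · obtain ⟨hb, -⟩ := mem_P4set.mp hz
      have : (1 : ℝ) - z k ^ 2 ≠ 0 := by nlinarith [(hb k).1, (hb k).2]
      have := one_add_sq_ne (z i); have := one_add_sq_ne (z k)
      simp [Sn, Cs]
      field_simp
  fin_cases j
  · simpa [cal4] using comp 0 1
  · simpa [cal4] using comp 1 2
  · simpa [cal4] using comp 2 3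
  · simpa [cal4] using comp 3 0

/-- Auxiliary lemma `Cs_ne_of_mem_P4` (see the module docstring). [folklore] -/
theorem Cs_ne_of_mem_P4 {z : Fin 4 → ℝ} (hz : z ∈ P4set) : ∀ i, Cs (z i) ≠ 0 := fun i =>
  (Cs_pos ((P4_facts hz).1 i)).ne'

/-- Positivity: `one_sub_X_pos`. [folklore] -/
theorem one_sub_X_pos {z : Fin 4 → ℝ} (hz : z ∈ P4set) :
    0 < 1 - (cal4 z 0) ^ 2 * (cal4 z 1) ^ 2 * (cal4 z 2) ^ 2 * (cal4 z 3) ^ 2 := by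
  linarith [prod_sq_lt_one (cal4_mem_cube hz)]

/-- The determinant of `cal4Deriv_pos`. [folklore] -/
theorem det_cal4Deriv_pos {z : Fin 4 → ℝ} (hz : z ∈ P4set) : 0 < (cal4Deriv z).det := by
  rw [det_cal4Deriv (Cs_ne_of_mem_P4 hz)]
  exact mul_pos (mul_pos (mul_pos (gq_pos _) (gq_pos _)) (mul_pos (gq_pos _) (gq_pos _))) (one_sub_X_pos hz)

/-- `[□⁴, 1/(1 − x₀²x₁²x₂²x₃²)]` (value `Σ_{odd} n⁻⁴ = (15/16)ζ(4)`), integrability transported from `P₄`. [folklore] -/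
def L4rep : KZ.IntegralRep 4 where
  domain := openUnitCube 4
  integrand w := 1 / (1 - w 0 ^ 2 * w 1 ^ 2 * w 2 ^ 2 * w 3 ^ 2)
  isSemialgebraic_domain := isSemialgebraic_openUnitCube
  isSemialgebraicFunOn_integrand := by
    refine (isSemialgebraicFunOn_aeval_div_aeval (isSemialgebraic_openUnitCube (d := 4))
      (1 : MvPolynomial (Fin 4) ℚ) (1 - X 0 ^ 2 * X 1 ^ 2 * X 2 ^ 2 * X 3 ^ 2) fun w hw => ?_).congr fun w hw => ?_
    · simp only [map_sub, map_one, map_mul, map_pow, aeval_X]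
      linarith [prod_sq_lt_one hw]
    · simp
  integrableOn := by
    have key : ∀ z ∈ P4set, |(cal4Deriv z).det| •
        (fun w : Fin 4 → ℝ => 1 / (1 - w 0 ^ 2 * w 1 ^ 2 * w 2 ^ 2 * w 3 ^ 2)) (cal4 z) = P4rep.integrand z := by
      intro z hz
      rw [abs_of_pos (det_cal4Deriv_pos hz), det_cal4Deriv (Cs_ne_of_mem_P4 hz), smul_eq_mul]
      change _ = G4.integrand z
      rw [G4_integrand_apply]
      have := (one_sub_X_pos hz).ne'
      field_simp
    have hf' : ∀ z ∈ P4set, HasFDerivWithinAt cal4 (cal4Deriv z) P4set z := fun z hz =>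
      (hasFDerivAt_cal4 (Cs_ne_of_mem_P4 hz)).hasFDerivWithinAt
    have h := (integrableOn_image_iff_integrableOn_abs_det_fderiv_smul volume
      (sa_P4set.measurableSet_holds) hf' injOn_cal4
      (fun w : Fin 4 → ℝ => 1 / (1 - w 0 ^ 2 * w 1 ^ 2 * w 2 ^ 2 * w 3 ^ 2))).mpr
      (P4rep.integrableOn.congr_fun (fun z hz => (key z hz).symm) sa_P4set.measurableSet_holds)
    rwa [image_cal4] at h

/-- **The Calabi change of variables in dimension 4 is ONE move.** [folklore] -/
theorem P4rep_sub_L4rep_mem_cov : KZ.of P4rep - KZ.of L4rep ∈ KZ.changeOfVariablesRel := by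
  refine ⟨4, P4rep, L4rep, cal4, fun z => cal4Deriv z, isSemialgebraicMapOn_cal4,
    fun z hz => (hasFDerivAt_cal4 (Cs_ne_of_mem_P4 hz)).hasFDerivWithinAt, injOn_cal4, image_cal4.symm,
    fun z hz => ?_, rfl⟩
  change G4.integrand z = (1 / (1 - (cal4 z 0) ^ 2 * (cal4 z 1) ^ 2 * (cal4 z 2) ^ 2 * (cal4 z 3) ^ 2)) *
    |(cal4Deriv z).det|
  rw [abs_of_pos (det_cal4Deriv_pos hz), det_cal4Deriv (Cs_ne_of_mem_P4 hz), G4_integrand_apply]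
  have := (one_sub_X_pos hz).ne'
  field_simp

/-- **`Q⁴ ≡ 6·[□⁴, 1/(1−∏xᵢ²)]`** (`(π/2)⁴ = 6 · Σ_{odd} n⁻⁴`). [folklore] -/
theorem of_G4_sub_six_L4rep_mem : KZ.of G4 - 6 • KZ.of L4rep ∈ KZ.relations := by
  have h1 := of_G4_sub_six_P4rep_mem
  have h2 := KZ.changeOfVariablesRel_subset_relations P4rep_sub_L4rep_mem_cov
  have : KZ.of G4 - 6 • KZ.of L4rep = (KZ.of G4 - 6 • KZ.of P4rep) + 6 • (KZ.of P4rep - KZ.of L4rep) := by abel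
  rw [this]
  exact add_mem h1 (KZ.relations.nsmul_mem h2 6)

end Summit.KontsevichZagierPeriods.MzvKernelInKZ.Negative
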